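import Summits.AtomisticToContinuum.Crystallization.Theses.DisclinationRation
import Summits.AtomisticToContinuum.Crystallization.Theses.BrittleRungDescent
import Summits.AtomisticToContinuum.Crystallization.Theorems.HullExactificationCascadeHullGoodEverywhere
import Summits.AtomisticToContinuum.Crystallization.Theorems.HullExactificationCascadeZeroDefectDensityReductionFinal
import HarnessLib

/-!
# Crux `AlphabetGoodHullElement` (route `DisclinationRation`, stmt-AtomisticToContinuum-15798), line `birth`:
# the crux is NO HARDER than the sibling crux `ZeroDefectDensity` (stmt-12086) and its two open inputs

Two kernel-checked reductions, recorded for the ledger (they do not close the item):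

* `alphabetGoodHullElement_of_zeroDefectDensity` — `HullExactificationCascade.ZeroDefectDensity →
  DisclinationRation.AlphabetGoodHullElement`: the PROVED exactification `hullGoodEverywhere_proof`
  (stmt-12089) turns a vanishing `{fcc, hcp}`-defect fraction into an everywhere `{fcc, hcp}`-good,
  `δ`-separated, relatively dense hull element `S ∋ 0`; an `{fcc, hcp}`-good site is alphabet-good
  (the enlarged alphabet `{fcc, hcp, decahedral axis}` contains the old one), so the same `S` witnesses
  the crux.  (The refuter's vetting artefact `Reduction.lean` of 2026-08-17 states the same implication;
  here it lands in the tree.)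
* `alphabetGoodHullElement_of_softKissingOrder_of_localHalesKernel` — composing with the sibling
  line's landed final reduction
  `ZeroDefectDensityBirth.zeroDefectDensity_reduction_of_softKissingOrder_of_localHalesKernel`:
  SOFT KISSING ORDER a.e. along Lennard-Jones ground states (tolerance `1/4000`, two shells deep, gap
  `131/100`; the sibling's open ENERGETIC stub) and the effective local Hales kernel
  `BrittleRungDescent.LocalHalesKernel` (stmt-9208, tolerance `1/400`; open, pure geometry) imply the
  crux.  So, as of this file, crux 15798 is closed modulo EXACTLY the two open inputs of crux 12086;
  the line `birth` (stubs `stub_alphabetCleanHullElement`, `stub_alphabetGoodRelDense` landed) asks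
  instead for the WEAKER energetic input `stub_zeroAlphabetDefectDensity` (decahedral-axis shells are
  good there and need not be priced).
-/

noncomputable section

namespace Summit.AtomisticToContinuum.Crystallization.Theorems.AlphabetGoodHullElementBirth

open Summit.AtomisticToContinuum.Crystallization.Theses

/-- **The crux from the sibling crux.** `ZeroDefectDensity` (stmt-12086: the `1/20`-`{fcc,hcp}`-defect
fraction of Lennard-Jones ground states tends to `0`) implies `AlphabetGoodHullElement` (stmt-15798):
feed it to the proved exactification `hullGoodEverywhere_proof` (stmt-12089) and observe that an
`{fcc, hcp}`-good site is alphabet-good (first two letters of the enlarged alphabet). [folklore] -/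
theorem alphabetGoodHullElement_of_zeroDefectDensity : Summit.AtomisticToContinuum.Crystallization.Theses.HullExactificationCascade.ZeroDefectDensity → Summit.AtomisticToContinuum.Crystallization.Theses.DisclinationRation.AlphabetGoodHullElement := by
  intro hZ x hx
  obtain ⟨S, δ, hδ, hsep, h0, hHL, hgood, hdense⟩ := hullGoodEverywhere_proof x hx (hZ x hx)
  refine ⟨S, δ, hδ, hsep, h0, hHL, fun y hy => ?_, hdense⟩
  obtain ⟨A, h | h⟩ := hgood y hy
  · exact ⟨A, Or.inl h⟩
  · exact ⟨A, Or.inr (Or.inl h)⟩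

/-- **The crux from the two open inputs of the sibling line.** Soft kissing order almost everywhere
along Lennard-Jones ground states (tolerance `1/4000`, two shells deep, gap `131/100` — the open
energetic stub of `Cruxes/ZeroDefectDensity/Lines/birth.lean`, displayed verbatim) and the effective
local Hales kernel `BrittleRungDescent.LocalHalesKernel` (stmt-9208) imply `AlphabetGoodHullElement`:
compose `ZeroDefectDensityBirth.zeroDefectDensity_reduction_of_softKissingOrder_of_localHalesKernel`
with `alphabetGoodHullElement_of_zeroDefectDensity`. [folklore] -/
theorem alphabetGoodHullElement_of_softKissingOrder_of_localHalesKernel : (∀ (x : (N : ℕ) → (Fin N → EuclideanSpace ℝ (Fin 3))), (∀ N, Literature.MathematicalPhysics.StatisticalMechanics.IsGroundState Literature.MathematicalPhysics.StatisticalMechanics.lennardJones (x N)) → Filter.Tendsto (fun N : ℕ => (Nat.card {i : Fin N // ¬ (∃ a : ℝ, 0 < a ∧ ∀ v ∈ Set.range (x N), dist (x N i) v ≤ 13 / 5 * a → ((∀ w ∈ Set.range (x N), w ≠ v → (1 - 1 / 4000) * a ≤ dist v w ∧ (dist v w ≤ (1 + 1 / 4000) * a ∨ 131 / 100 * a ≤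 dist v w)) ∧ {w ∈ Set.range (x N) | w ≠ v ∧ dist v w ≤ (1 + 1 / 4000) * a}.ncard = 12))} : ℝ) / (N : ℝ)) Filter.atTop (nhds (0 : ℝ))) → Summit.AtomisticToContinuum.Crystallization.Theses.BrittleRungDescent.LocalHalesKernel → Summit.AtomisticToContinuum.Crystallization.Theses.DisclinationRation.AlphabetGoodHullElement :=
  fun hSKO hLHK => alphabetGoodHullElement_of_zeroDefectDensity
    (ZeroDefectDensityBirth.zeroDefectDensity_reduction_of_softKissingOrder_of_localHalesKernel hSKO hLHK)

end Summit.AtomisticToContinuum.Crystallization.Theorems.AlphabetGoodHullElementBirth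

end
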